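import Summits.ValiantsHypothesis.ValiantsHypothesis.Theorems.DefinabilityGapFourGatesTools
import Summits.ValiantsHypothesis.ValiantsHypothesis.Theorems.DefinabilityGapGraphicalThree
import HarnessLib

/-!
# Definability gap — GRAPHICAL ΣΠΣ(4) WITH PAIRWISE EDGE-DISJOINT GATES (O-L5-LEVEL, F-N₃b): THEOREM B

Helper lane `--supports stmt-ValiantsHypothesis-23704 --as helper` (cites KabanetsImpagliazzo2003,
NisanWigderson1994); route `route-ValiantsHypothesis-DefinabilityGap` (draft). THEOREM B
`kiPer_hits_graphicalFour_coprime` (pinned header): for `m ≥ 8`, `G_m = bind₁ (kiPer m)` hits every NONZERO `f =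
Σ_{i≤4} C α_i · eprod E_i` whose four gates are on ORIENTED edges (`toLex e.1 < toLex e.2`) and PAIRWISE
EDGE-DISJOINT — arbitrary sizes, EVERY union support (cyclic included).

PROOF (BY NAME; the tools are `DefinabilityGapFourGatesTools`, nothing re-derived). (Z) a zero coefficient:
graphical ΣΠΣ(3) `kiPer_hits_graphicalThree` (`m ≥ 5`). (S) SIZES not all equal: `φ` maps a gate of size `n` to a
homogeneous polynomial of degree `n·m` (`isHomogeneous_kiPer_eprod`), so `φ f = 0` kills the sub-sum `f₁` of the
gates of the size of `E₁` (`homogeneousComponent`), and `f₁` misses a gate: if `f₁ ≠ 0` this contradicts (Z); else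
`f = f − f₁` has the zero coefficient of `E₁` and (Z) applies again. (E) EQUAL SIZES, all coefficients nonzero, all
gates nonempty (else `f` is a nonzero constant); suppose `φ f = 0`. (E3a) a FREE collapse `ρ_e f ≠ 0` (for `e` in
any of the four gates, the sum reordered by `ring`) is excluded by `kiPer_fourGates_free`. (E3b) STUCK:
`fourGates_stuck_labels` from an edge of `E₁` puts all endpoints of `E₂ + E₃ + E₄` into at most five labels, and
from an edge of `E₂` those of `E₁ + E₃ + E₄`; hence `vars f` has at most ten labels (`vars_C_mul_eprod_subset`) and
the SUPPORT RUNG `kiPer_hits_support` (`2·9 = 18 < 64 ≤ m²`) gives `φ f ≠ 0` — contradiction. WHY ONLY PAIRWISE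
EDGE-DISJOINT: with an edge `e` in exactly two gates, `ρ_e` kills both and the STUCK case `ρ_e f = 0` makes the two
other collapsed gates slide-equivalent — deciding it needs the classification (CL4) of slide-equivalent gate pairs,
not done here.

HONEST BOUNDARY (O-L5-LEVEL): proved here are (A) level-stable survival of THREE equal-size graphical gates on
oriented live edges under every patch list L whose merged labels are pairwise distinct, with 2·3^(|L|+2) < m², and
(B) hitting by G_m of every nonzero sum of FOUR pairwise edge-disjoint graphical gates on oriented edges for m ≥ 8,
on every union support; NOT claimed: four gates with an edge shared by exactly two of them (this needs a
classification of slide-equivalent gate pairs, not done), five or more gates (the free recursion leaves the pairwise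
edge-disjoint class), the k-set analogue of the four-label count, affine non-graphical forms, the leaf regime;
nothing here is S-currency, no item closes, stmt-23704 and VP ≠ VNP are untouched.

LABEL (RULING 3152, verbatim): «O-L5-LEVEL (lens-5 g40): ELEMENTARY · NEW-COMBINATION (the KEPT free-form dichotomy
of g39 + the patched NW-design support rung of F-H / F-M₁ + MERGE-KILLS-TWO + a NEW z-side count (CL3) — slide
identities in all six directions force ≤ 4 labels, tight at K₄ — i.e. the Dvir–Shpilka / Karnin–Shpilka paradigm of
ΣΠΣ(k) PIT (identities have low rank ⟹ reduce to few variables ⟹ hit by the support rung), here EXACT and ELEMENTARY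
for graphic gates and run on the z-side of the dichotomy; levers each with precedent on this problem or its PIT
reformulation, the junction and the level-stability pay-off new) · PROVES (restricted-model cells of (α″) only): (A)
three graphical gates of one size on oriented LIVE edges survive EVERY hB-patch level L with 2·3^(|L|+2) < m² —
Mason-free, primality-free; (B) G_m = bind₁ (kiPer m) hits every nonzero graphical ΣΠΣ(4) circuit with PAIRWISE
EDGE-DISJOINT gates on oriented edges, arbitrary sizes, EVERY union support (cyclic included), m ≥ 8 · NOT decided:
fan-in 4 with an edge shared by exactly two gates, fan-in ≥ 5, the k-set analogue of (CL3), (β) affine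
non-graphical, (γ) leaf regime — UNDECIDED · IDEA-NEEDED · 0 S-currency · closes NO item · stmt-23704 TEXT / K1 / VP
≠ VNP untouched»

0 S-currency · closes NO item · stmt-23704 TEXT / K1 / VP ≠ VNP untouched · UNDECIDED · IDEA-NEEDED.
-/

open MvPolynomial
open Literature.Computability.AlgebraicComplexity Literature.Computability.MetaComplexity
open Summit.ValiantsHypothesis.ValiantsHypothesis.Theorems.DefinabilityGapAffineRung
open Summit.ValiantsHypothesis.ValiantsHypothesis.Theorems.DefinabilityGapBlockMerging
open Summit.ValiantsHypothesis.ValiantsHypothesis.Theorems.DefinabilityGapClusterMerging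
open Summit.ValiantsHypothesis.ValiantsHypothesis.Theorems.DefinabilityGapForestSums
open Summit.ValiantsHypothesis.ValiantsHypothesis.Theorems.DefinabilityGapSupportRung
open Summit.ValiantsHypothesis.ValiantsHypothesis.Theorems.DefinabilityGapEdgeGates
open Summit.ValiantsHypothesis.ValiantsHypothesis.Theorems.DefinabilityGapSlideCount
open Summit.ValiantsHypothesis.ValiantsHypothesis.Theorems.DefinabilityGapSlideSupport
open Summit.ValiantsHypothesis.ValiantsHypothesis.Theorems.DefinabilityGapThreeGatesPatched
open Summit.ValiantsHypothesis.ValiantsHypothesis.Theorems.DefinabilityGapGraphicalThree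
open Summit.ValiantsHypothesis.ValiantsHypothesis.Theorems.DefinabilityGapFourGatesTools

set_option linter.dupNamespace false

namespace Summit.ValiantsHypothesis.ValiantsHypothesis.Theorems.DefinabilityGapGraphicalFour

variable {m : ℕ}

/-! ## THEOREM B -/

/-- THEOREM B: `G_m` hits every nonzero graphical ΣΠΣ(4) circuit with PAIRWISE EDGE-DISJOINT gates on oriented
edges — any union support, cyclic included — for `m ≥ 8`. -/
theorem kiPer_hits_graphicalFour_coprime (hm : 8 ≤ m)
    {E₁ E₂ E₃ E₄ : Multiset ((Fin 3 → Fin (qOf m)) × (Fin 3 → Fin (qOf m)))}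
    (ho : ∀ e ∈ E₁ + E₂ + E₃ + E₄, toLex e.1 < toLex e.2)
    (h₁₂ : ∀ e ∈ E₁, e ∉ E₂) (h₁₃ : ∀ e ∈ E₁, e ∉ E₃) (h₁₄ : ∀ e ∈ E₁, e ∉ E₄)
    (h₂₃ : ∀ e ∈ E₂, e ∉ E₃) (h₂₄ : ∀ e ∈ E₂, e ∉ E₄) (h₃₄ : ∀ e ∈ E₃, e ∉ E₄) {α₁ α₂ α₃ α₄ : ℂ}
    (hf : C α₁ * eprod E₁ + C α₂ * eprod E₂ + C α₃ * eprod E₃ + C α₄ * eprod E₄ ≠ 0) :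
    bind₁ (kiPer m) (C α₁ * eprod E₁ + C α₂ * eprod E₂ + C α₃ * eprod E₃ + C α₄ * eprod E₄) ≠ 0 := by
  have hm5 : 5 ≤ m := by omega
  have hm0 : 0 < m := by omega
  have mE₁ : ∀ d ∈ E₁, d ∈ E₁ + E₂ + E₃ + E₄ := fun d hd =>
    Multiset.mem_add.2 (Or.inl (Multiset.mem_add.2 (Or.inl (Multiset.mem_add.2 (Or.inl hd)))))
  have mE₂ : ∀ d ∈ E₂, d ∈ E₁ + E₂ + E₃ + E₄ := fun d hd =>
    Multiset.mem_add.2 (Or.inl (Multiset.mem_add.2 (Or.inl (Multiset.mem_add.2 (Or.inr hd)))))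
  have ho₁ : ∀ e ∈ E₁, toLex e.1 < toLex e.2 := fun e he => ho e (mE₁ e he)
  have ho₂ : ∀ e ∈ E₂, toLex e.1 < toLex e.2 := fun e he => ho e (mE₂ e he)
  have ho₃ : ∀ e ∈ E₃, toLex e.1 < toLex e.2 := fun e he =>
    ho e (Multiset.mem_add.2 (Or.inl (Multiset.mem_add.2 (Or.inr he))))
  have ho₄ : ∀ e ∈ E₄, toLex e.1 < toLex e.2 := fun e he => ho e (Multiset.mem_add.2 (Or.inr he))
  have ho' : ∀ {P Q R S : Multiset ((Fin 3 → Fin (qOf m)) × (Fin 3 → Fin (qOf m)))},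
      (∀ d ∈ P, toLex d.1 < toLex d.2) → (∀ d ∈ Q, toLex d.1 < toLex d.2) → (∀ d ∈ R, toLex d.1 < toLex d.2) →
      (∀ d ∈ S, toLex d.1 < toLex d.2) → ∀ d ∈ P + Q + R + S, toLex d.1 < toLex d.2 := by
    intro P Q R S hP hQ hR hS d hd
    rcases Multiset.mem_add.1 hd with hd | hd
    · rcases Multiset.mem_add.1 hd with hd | hd
      · rcases Multiset.mem_add.1 hd with hd | hd
        exacts [hP d hd, hQ d hd]
      · exact hR d hd
    · exact hS d hd
  -- (Z) a zero coefficient: graphical ΣΠΣ(3), `m ≥ 5`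
  have hZ : ∀ γ₁ γ₂ γ₃ γ₄ : ℂ, (γ₁ = 0 ∨ γ₂ = 0 ∨ γ₃ = 0 ∨ γ₄ = 0) →
      C γ₁ * eprod E₁ + C γ₂ * eprod E₂ + C γ₃ * eprod E₃ + C γ₄ * eprod E₄ ≠ 0 →
      bind₁ (kiPer m) (C γ₁ * eprod E₁ + C γ₂ * eprod E₂ + C γ₃ * eprod E₃ + C γ₄ * eprod E₄) ≠ 0 := by
    rintro γ₁ γ₂ γ₃ γ₄ (rfl | rfl | rfl | rfl) hg
    · rw [C_0, zero_mul, zero_add] at hg ⊢; exact kiPer_hits_graphicalThree hm5 ho₂ ho₃ ho₄ hg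
    · rw [C_0, zero_mul, add_zero] at hg ⊢; exact kiPer_hits_graphicalThree hm5 ho₁ ho₃ ho₄ hg
    · rw [C_0, zero_mul, add_zero] at hg ⊢; exact kiPer_hits_graphicalThree hm5 ho₁ ho₂ ho₄ hg
    · rw [C_0, zero_mul, add_zero] at hg ⊢; exact kiPer_hits_graphicalThree hm5 ho₁ ho₂ ho₃ hg
  by_cases hsz : Multiset.card E₂ = Multiset.card E₁ ∧ Multiset.card E₃ = Multiset.card E₁ ∧
      Multiset.card E₄ = Multiset.card E₁
  swap
  · -- (S) SIZES: the gates of the size of `E₁` form a proper sub-family; read its homogeneous component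
    intro h0
    have hcomp : ∀ n : ℕ, bind₁ (kiPer m)
        (C (if Multiset.card E₁ = n then α₁ else 0) * eprod E₁ +
          C (if Multiset.card E₂ = n then α₂ else 0) * eprod E₂ +
          C (if Multiset.card E₃ = n then α₃ else 0) * eprod E₃ +
          C (if Multiset.card E₄ = n then α₄ else 0) * eprod E₄) = 0 := by
      intro n
      have key : ∀ (N : Multiset ((Fin 3 → Fin (qOf m)) × (Fin 3 → Fin (qOf m)))) (γ : ℂ),
          homogeneousComponent (n * m) (bind₁ (kiPer m) (C γ * eprod N)) =
            bind₁ (kiPer m) (C (if Multiset.card N = n then γ else 0) * eprod N) := by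
        intro N γ
        rw [map_mul, bind₁_C_right, homogeneousComponent_C_mul,
          homogeneousComponent_of_mem (isHomogeneous_kiPer_eprod N), map_mul, bind₁_C_right]
        by_cases hN : Multiset.card N = n
        · rw [if_pos (by rw [hN]), if_pos hN]
        · rw [if_neg (fun h => hN (Nat.eq_of_mul_eq_mul_right hm0 h).symm), if_neg hN, C_0, zero_mul, mul_zero]
      have hc := congrArg (homogeneousComponent (n * m)) h0
      rw [map_add, map_add, map_add, map_add, map_add, map_add, map_zero, key, key, key, key, ← map_add,
        ← map_add, ← map_add] at hc
      exact hc
    have h1 := hcomp (Multiset.card E₁)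
    rw [if_pos rfl] at h1
    have hζ : (if Multiset.card E₂ = Multiset.card E₁ then α₂ else 0) = 0 ∨
        (if Multiset.card E₃ = Multiset.card E₁ then α₃ else 0) = 0 ∨
        (if Multiset.card E₄ = Multiset.card E₁ then α₄ else 0) = 0 := by
      by_cases h2 : Multiset.card E₂ = Multiset.card E₁
      · by_cases h3 : Multiset.card E₃ = Multiset.card E₁
        · exact Or.inr (Or.inr (if_neg fun h4 => hsz ⟨h2, h3, h4⟩))
        · exact Or.inr (Or.inl (if_neg h3))
      · exact Or.inl (if_neg h2)
    by_cases hf₁ : C α₁ * eprod E₁ + C (if Multiset.card E₂ = Multiset.card E₁ then α₂ else 0) * eprod E₂ +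
        C (if Multiset.card E₃ = Multiset.card E₁ then α₃ else 0) * eprod E₃ +
        C (if Multiset.card E₄ = Multiset.card E₁ then α₄ else 0) * eprod E₄ = 0
    · -- the sub-family sum vanishes: `f` is the complementary sum, which has the zero coefficient of `E₁`
      have hite : ∀ (p : Prop) [Decidable p] (a : ℂ) (P : MvPolynomial (Fin 3 → Fin (qOf m)) ℂ),
          C (if p then a else 0) * P + C (if p then 0 else a) * P = C a * P := by
        intro p _ a P
        by_cases hp : p
        · rw [if_pos hp, if_pos hp, C_0, zero_mul, add_zero]
        · rw [if_neg hp, if_neg hp, C_0, zero_mul, zero_add]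
      have hsplit : C α₁ * eprod E₁ + C α₂ * eprod E₂ + C α₃ * eprod E₃ + C α₄ * eprod E₄ =
          (C α₁ * eprod E₁ + C (if Multiset.card E₂ = Multiset.card E₁ then α₂ else 0) * eprod E₂ +
            C (if Multiset.card E₃ = Multiset.card E₁ then α₃ else 0) * eprod E₃ +
            C (if Multiset.card E₄ = Multiset.card E₁ then α₄ else 0) * eprod E₄) +
          (C 0 * eprod E₁ + C (if Multiset.card E₂ = Multiset.card E₁ then 0 else α₂) * eprod E₂ +
            C (if Multiset.card E₃ = Multiset.card E₁ then 0 else α₃) * eprod E₃ +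
            C (if Multiset.card E₄ = Multiset.card E₁ then 0 else α₄) * eprod E₄) := by
        rw [C_0, zero_mul, zero_add, ← hite (Multiset.card E₂ = Multiset.card E₁) α₂ (eprod E₂),
          ← hite (Multiset.card E₃ = Multiset.card E₁) α₃ (eprod E₃),
          ← hite (Multiset.card E₄ = Multiset.card E₁) α₄ (eprod E₄)]
        ring
      rw [hf₁, zero_add] at hsplit
      refine hZ 0 (if Multiset.card E₂ = Multiset.card E₁ then 0 else α₂)
        (if Multiset.card E₃ = Multiset.card E₁ then 0 else α₃)
        (if Multiset.card E₄ = Multiset.card E₁ then 0 else α₄)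
        (Or.inl rfl) ?_ ?_
      · rw [← hsplit]; exact hf
      · rw [← hsplit]; exact h0
    · exact hZ α₁ _ _ _ (Or.inr hζ) hf₁ h1
  -- (E) EQUAL SIZES
  obtain ⟨c₂, c₃, c₄⟩ := hsz
  by_cases hz : α₁ = 0 ∨ α₂ = 0 ∨ α₃ = 0 ∨ α₄ = 0
  · exact hZ α₁ α₂ α₃ α₄ hz hf
  have hα₁ : α₁ ≠ 0 := fun h => hz (Or.inl h)
  have hα₂ : α₂ ≠ 0 := fun h => hz (Or.inr (Or.inl h))
  have hα₃ : α₃ ≠ 0 := fun h => hz (Or.inr (Or.inr (Or.inl h)))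
  have hα₄ : α₄ ≠ 0 := fun h => hz (Or.inr (Or.inr (Or.inr h)))
  by_cases hE₁ : E₁ = 0
  · have h2 : E₂ = 0 := Multiset.card_eq_zero.1 (by rw [c₂, hE₁, Multiset.card_zero])
    have h3 : E₃ = 0 := Multiset.card_eq_zero.1 (by rw [c₃, hE₁, Multiset.card_zero])
    have h4 : E₄ = 0 := Multiset.card_eq_zero.1 (by rw [c₄, hE₁, Multiset.card_zero])
    rw [hE₁, h2, h3, h4, eprod_zero, mul_one, mul_one, mul_one, mul_one, ← C_add, ← C_add, ← C_add] at hf ⊢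
    rw [bind₁_C_right, Ne, C_eq_zero]; exact fun h => hf (by rw [h, C_0])
  have hE₂ : E₂ ≠ 0 := fun h => hE₁ (Multiset.card_eq_zero.1 (by rw [← c₂, h, Multiset.card_zero]))
  have hE₃ : E₃ ≠ 0 := fun h => hE₁ (Multiset.card_eq_zero.1 (by rw [← c₃, h, Multiset.card_zero]))
  intro h0
  -- (E3a) a FREE collapse
  by_cases hfree : ∃ e ∈ E₁ + E₂ + E₃ + E₄,
      rename (repL [e]) (C α₁ * eprod E₁ + C α₂ * eprod E₂ + C α₃ * eprod E₃ + C α₄ * eprod E₄) ≠ 0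
  · obtain ⟨e, he, hρ⟩ := hfree
    rcases Multiset.mem_add.1 he with he | he₄
    · rcases Multiset.mem_add.1 he with he | he₃
      · rcases Multiset.mem_add.1 he with he₁ | he₂
        · exact kiPer_fourGates_free hm ho h₁₂ h₁₃ h₁₄ (c₃.trans c₂.symm) (c₄.trans c₂.symm) he₁ hρ h0
        · have ef : C α₂ * eprod E₂ + C α₁ * eprod E₁ + C α₃ * eprod E₃ + C α₄ * eprod E₄ =
              C α₁ * eprod E₁ + C α₂ * eprod E₂ + C α₃ * eprod E₃ + C α₄ * eprod E₄ := by ring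
          refine kiPer_fourGates_free hm (F₁ := E₂) (F₂ := E₁) (F₃ := E₃) (F₄ := E₄) (γ₁ := α₂) (γ₂ := α₁)
            (γ₃ := α₃) (γ₄ := α₄)
            (ho' ho₂ ho₁ ho₃ ho₄)
            (fun d hd hd' => h₁₂ d hd' hd) h₂₃ h₂₄ c₃ c₄ he₂ ?_ ?_
          · rw [ef]; exact hρ
          · rw [ef]; exact h0
      · have ef : C α₃ * eprod E₃ + C α₁ * eprod E₁ + C α₂ * eprod E₂ + C α₄ * eprod E₄ =
            C α₁ * eprod E₁ + C α₂ * eprod E₂ + C α₃ * eprod E₃ + C α₄ * eprod E₄ := by ring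
        refine kiPer_fourGates_free hm (F₁ := E₃) (F₂ := E₁) (F₃ := E₂) (F₄ := E₄) (γ₁ := α₃) (γ₂ := α₁)
          (γ₃ := α₂) (γ₄ := α₄)
          (ho' ho₃ ho₁ ho₂ ho₄)
          (fun d hd hd' => h₁₃ d hd' hd) (fun d hd hd' => h₂₃ d hd' hd) h₃₄ c₂ c₄ he₃ ?_ ?_
        · rw [ef]; exact hρ
        · rw [ef]; exact h0
    · have ef : C α₄ * eprod E₄ + C α₁ * eprod E₁ + C α₂ * eprod E₂ + C α₃ * eprod E₃ =
          C α₁ * eprod E₁ + C α₂ * eprod E₂ + C α₃ * eprod E₃ + C α₄ * eprod E₄ := by ring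
      refine kiPer_fourGates_free hm (F₁ := E₄) (F₂ := E₁) (F₃ := E₂) (F₄ := E₃) (γ₁ := α₄) (γ₂ := α₁)
        (γ₃ := α₂) (γ₄ := α₃)
        (ho' ho₄ ho₁ ho₂ ho₃)
        (fun d hd hd' => h₁₄ d hd' hd) (fun d hd hd' => h₂₄ d hd' hd) (fun d hd hd' => h₃₄ d hd' hd) c₂ c₃ he₄
        ?_ ?_
      · rw [ef]; exact hρ
      · rw [ef]; exact h0
  -- (E3b) STUCK: every collapse kills `f`; count labels from an edge of `E₁` and from an edge of `E₂`
  have hall : ∀ e ∈ E₁ + E₂ + E₃ + E₄,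
      rename (repL [e]) (C α₁ * eprod E₁ + C α₂ * eprod E₂ + C α₃ * eprod E₃ + C α₄ * eprod E₄) = 0 := by
    intro e he
    by_contra h
    exact hfree ⟨e, he, h⟩
  obtain ⟨e₁, he₁⟩ := Multiset.exists_mem_of_ne_zero hE₁
  obtain ⟨e₂, he₂⟩ := Multiset.exists_mem_of_ne_zero hE₂
  obtain ⟨T₁, hT₁, hT₁m⟩ := fourGates_stuck_labels ho h₁₂ h₁₃ h₁₄ h₂₃ h₂₄ h₃₄ hα₂ hα₃ hα₄ hE₂ hE₃ he₁
    (hall e₁ (mE₁ e₁ he₁))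
  have ef : C α₂ * eprod E₂ + C α₁ * eprod E₁ + C α₃ * eprod E₃ + C α₄ * eprod E₄ =
      C α₁ * eprod E₁ + C α₂ * eprod E₂ + C α₃ * eprod E₃ + C α₄ * eprod E₄ := by ring
  obtain ⟨T₂, hT₂, hT₂m⟩ := fourGates_stuck_labels (F₁ := E₂) (F₂ := E₁) (F₃ := E₃) (F₄ := E₄)
    (ho' ho₂ ho₁ ho₃ ho₄) (fun d hd hd' => h₁₂ d hd' hd) h₂₃ h₂₄
    h₁₃ h₁₄ h₃₄ hα₁ hα₃ hα₄ hE₁ hE₃ he₂ (by rw [ef]; exact hall e₂ (mE₂ e₂ he₂))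
  have g₁ : ∀ d ∈ E₁, d.1 ∈ T₁ ∪ T₂ ∧ d.2 ∈ T₁ ∪ T₂ := fun d hd =>
    ⟨Finset.mem_union_right _ (hT₂m d (Multiset.mem_add.2 (Or.inl (Multiset.mem_add.2 (Or.inl hd))))).1,
      Finset.mem_union_right _ (hT₂m d (Multiset.mem_add.2 (Or.inl (Multiset.mem_add.2 (Or.inl hd))))).2⟩
  have g₂ : ∀ d ∈ E₂, d.1 ∈ T₁ ∪ T₂ ∧ d.2 ∈ T₁ ∪ T₂ := fun d hd =>
    ⟨Finset.mem_union_left _ (hT₁m d (Multiset.mem_add.2 (Or.inl (Multiset.mem_add.2 (Or.inl hd))))).1,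
      Finset.mem_union_left _ (hT₁m d (Multiset.mem_add.2 (Or.inl (Multiset.mem_add.2 (Or.inl hd))))).2⟩
  have g₃ : ∀ d ∈ E₃, d.1 ∈ T₁ ∪ T₂ ∧ d.2 ∈ T₁ ∪ T₂ := fun d hd =>
    ⟨Finset.mem_union_left _ (hT₁m d (Multiset.mem_add.2 (Or.inl (Multiset.mem_add.2 (Or.inr hd))))).1,
      Finset.mem_union_left _ (hT₁m d (Multiset.mem_add.2 (Or.inl (Multiset.mem_add.2 (Or.inr hd))))).2⟩
  have g₄ : ∀ d ∈ E₄, d.1 ∈ T₁ ∪ T₂ ∧ d.2 ∈ T₁ ∪ T₂ := fun d hd =>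
    ⟨Finset.mem_union_left _ (hT₁m d (Multiset.mem_add.2 (Or.inr hd))).1,
      Finset.mem_union_left _ (hT₁m d (Multiset.mem_add.2 (Or.inr hd))).2⟩
  have hv : (C α₁ * eprod E₁ + C α₂ * eprod E₂ + C α₃ * eprod E₃ + C α₄ * eprod E₄).vars ⊆ T₁ ∪ T₂ :=
    (vars_add_subset _ _).trans (Finset.union_subset ((vars_add_subset _ _).trans (Finset.union_subset
      ((vars_add_subset _ _).trans (Finset.union_subset (vars_C_mul_eprod_subset g₁ α₁)
      (vars_C_mul_eprod_subset g₂ α₂))) (vars_C_mul_eprod_subset g₃ α₃))) (vars_C_mul_eprod_subset g₄ α₄))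
  have hcard : (C α₁ * eprod E₁ + C α₂ * eprod E₂ + C α₃ * eprod E₃ + C α₄ * eprod E₄).vars.card ≤ 10 :=
    (Finset.card_le_card hv).trans ((Finset.card_union_le _ _).trans (by omega))
  exact kiPer_hits_support m hf
    (lt_of_le_of_lt (by omega) (lt_of_lt_of_le (by norm_num : 18 < 8 * 8) (Nat.mul_le_mul hm hm))) h0

end Summit.ValiantsHypothesis.ValiantsHypothesis.Theorems.DefinabilityGapGraphicalFour
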